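import Summits.BirchSwinnertonDyer.BirchSwinnertonDyer.Theses.KatoDescentPotSupersingular
import Summits.BirchSwinnertonDyer.BirchSwinnertonDyer.Theorems.KatoDescentPotSupersingularReducibleUpperOfCountInputsNodes
import Literature.NumberTheory.EllipticCurves.Kato2004.IwasawaCohomologyExistsProofs
import HarnessLib

/-!
# Route `KatoDescentPotSupersingular` (rung K9, cell `bsd-potss`): the crux `ReducibleKatoMember`
# (item stmt-BirchSwinnertonDyer-19196, shared with K8-t′) and its held Z-child
# `PublishedInputMemberHullZetaInputs` (item 20278) FROM THE ROUTE'S OTHER HELD KATO PACKAGE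
# `PublishedInputMemberHullCountInputs` (item 19707, the U₀-red family) — the two held Kato inputs
# of the route are NOT independent

Seat `bsd-potss-rkm` generation 11.  The route holds TWO cite-level transcriptions of Kato's rank-`0`
descent at his member: `PublishedInputMemberHullZetaInputs := Kato2004.exists_memberHullZetaInputs`
(Z-child of crux M, gen-2 split of 19196) and `PublishedInputMemberHullCountInputs :=
Kato2004.exists_memberHullCountInputs` (child of U₀-red 19190, seat kmc part 16: the original package
`MemberHullInputs` + the two printed counts).  By two theorems already in the tree
(`Kato2004.exists_memberHullInputs_of_count`, kmc; `Kato2004.exists_memberHullZetaInputs_of_memberHullInputs`,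
typer lane) the SECOND IMPLIES THE FIRST; this file records that with the route decls as types, and the
crux itself from the count package BY NAME WITHOUT GZK (kmc's node
`ReducibleUpperOfCountInputs.katoMemberShaBoundOfReducible_of_memberCountInputs`, `nonempty_iwasawaH1Data`
discharged by its `_holds`).  So on this route crux M adds NO held Kato input beyond U₀-red's: the trust
base of {M, U₀-red} is {modularity, `exists_memberHullCountInputs`, Cassels, GZK} — documentary for the
planner (a gen-3 resplit of 19196 onto `PublishedInputNewformKatoRed → PublishedInputMemberHullCountInputs
→ ReducibleKatoMember` would be closed by `reducibleKatoMember_of_countInputs` below; whether to hang M on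
the count package (which still carries the eight now-proved clauses of `MemberHullInputs`) or on the
print-clean count-VALUE shell of `Kato2004/MemberHullCountValueInputs.lean` is the planner's choice).
CONDITIONAL (audit `proof.conditional`); no item is closed here.  HONEST FRAMING: BSD is not advanced;
nothing is booked; no trust base changes until a planner edit.

References: [Kato2004Asterisque] Thm. 12.5–12.6 (pp. 221–222), 13.14 (p. 234), §14.14 (p. 243),
Prop. 14.16 (2) (p. 244); [Wuthrich2014] Lemma 14; [GreenbergLNM1716] §3.
-/

set_option autoImplicit false
set_option linter.dupNamespace false

namespace Summit.BirchSwinnertonDyer.BirchSwinnertonDyer.Theorems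

open Literature.NumberTheory.EllipticCurves Literature.NumberTheory.EllipticCurves.ModularForms
  Literature.NumberTheory.EllipticCurves.Kato2004

/-- **The held Z-child of crux M follows from the held count child of U₀-red** (both route decls by name):
`PublishedInputMemberHullCountInputs → PublishedInputMemberHullZetaInputs` — forget the counts
(`exists_memberHullInputs_of_count`), then the four algebraic clauses
(`exists_memberHullZetaInputs_of_memberHullInputs`).  Conditional; nothing else assumed.
[cite: Kato2004Asterisque, Thm. 12.5 (1)–(3) (pp. 221–222), §14.14 (14.14.1) (p. 243), Prop. 14.16 (2) (p. 244)] -/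
theorem publishedInputMemberHullZetaInputs_of_countInputs
    (hC : Summit.BirchSwinnertonDyer.BirchSwinnertonDyer.Theses.KatoDescentPotSupersingular.PublishedInputMemberHullCountInputs) :
    Summit.BirchSwinnertonDyer.BirchSwinnertonDyer.Theses.KatoDescentPotSupersingular.PublishedInputMemberHullZetaInputs :=
  Kato2004.exists_memberHullZetaInputs_of_memberHullInputs (Kato2004.exists_memberHullInputs_of_count hC)

/-- **The K9 crux `ReducibleKatoMember` (item stmt-BirchSwinnertonDyer-19196; type = the route decl
verbatim) from the count package, WITHOUT GZK**: `exists_isNewformOf → exists_memberHullCountInputs →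
ReducibleKatoMember` — kmc's route-free node `katoMemberShaBoundOfReducible_of_memberCountInputs` with
`nonempty_iwasawaH1Data` discharged by `Kato2004.nonempty_iwasawaH1Data_holds` (rkm g4).  Conditional on
the two named facts; the item is not closed by this theorem.
[cite: Kato2004Asterisque, Thm. 12.6 (p. 222), §14.14 and Lemma 14.15 (pp. 243–244), Prop. 14.16 (2) (p. 244)]
[cite: Wuthrich2014, Lemma 14 (p. 396)] -/
theorem reducibleKatoMember_of_memberCountInputs (hmod : exists_isNewformOf)
    (hC : Kato2004.exists_memberHullCountInputs) :
    Summit.BirchSwinnertonDyer.BirchSwinnertonDyer.Theses.KatoDescentPotSupersingular.ReducibleKatoMember :=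
  ReducibleUpperOfCountInputs.katoMemberShaBoundOfReducible_of_memberCountInputs
    Kato2004.nonempty_iwasawaH1Data_holds hmod hC

/-- **Glue-shaped form in the binder order of the U₀-red glue 19711** (`PublishedInputIwasawaH1DataRed →
PublishedInputNewformKatoRed → PublishedInputMemberHullCountInputs → ReducibleKatoMember`; each alias
unfolds by `rfl`, so a planner's glue would be `fun h₁ h₂ h₃ => reducibleKatoMember_of_countInputs h₁ h₂ h₃`;
the first hypothesis is a theorem and is not used).  Conditional; nothing else assumed.
[cite: Kato2004Asterisque, Thm. 12.6 (p. 222), Prop. 14.16 (2) (p. 244)] [cite: Wuthrich2014, Lemma 14 (p. 396)] -/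
theorem reducibleKatoMember_of_countInputs (_hne : Kato2004.nonempty_iwasawaH1Data)
    (hmod : exists_isNewformOf) (hC : Kato2004.exists_memberHullCountInputs) :
    Summit.BirchSwinnertonDyer.BirchSwinnertonDyer.Theses.KatoDescentPotSupersingular.ReducibleKatoMember :=
  reducibleKatoMember_of_memberCountInputs hmod hC

/-- **Conjunction form**: `(exists_isNewformOf ∧ exists_memberHullCountInputs) → ReducibleKatoMember`.
Conditional; nothing else assumed. [cite: Kato2004Asterisque, Thm. 12.6 (p. 222), Prop. 14.16 (2) (p. 244)] -/
theorem reducibleKatoMember_of_countInputs_and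
    (h : exists_isNewformOf ∧ Kato2004.exists_memberHullCountInputs) :
    Summit.BirchSwinnertonDyer.BirchSwinnertonDyer.Theses.KatoDescentPotSupersingular.ReducibleKatoMember :=
  reducibleKatoMember_of_memberCountInputs h.1 h.2

end Summit.BirchSwinnertonDyer.BirchSwinnertonDyer.Theorems
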